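import Literature.Probability.RandomPlanarGeometry.SAWSubBallisticTheorem
import Literature.Probability.RandomPlanarGeometry.SAWPulledMeanExtension
import HarnessLib

/-!
# No spontaneous extension at zero force: the zero-force slope of `λ_B` is `0`, unconditionally (lane R47)

Topic `Literature/Probability/RandomPlanarGeometry` (continues `SAWPulledMeanExtension.lean` — the conditional
§3 "zero force" results `pulledBridgeFreeEnergy_exp_le_of_bridgeNotBallistic`, `zeroForce_secant_window_of_bridgeNotBallistic`
under the named fact `DuminilCopinHammond2013_bridgeNotBallistic` — and `SAWSubBallisticTheorem.lean` — the lane's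
«DCH-1.1» chain discharging that fact, `DuminilCopinHammond2013_bridgeNotBallistic_holds`).

Content (a-idea-1 g10, R47 «ZERO-FORCE ⟺ NOT BALLISTIC», the unconditional corollary; lead 11:42:10Z (2) /
11:49:26Z): on every `ℤ^{d+1}`, `d + 1 ≥ 2`, for every `v > 0` there is `s₀ > 0` with
`λ_B(e^s) ≤ log μ + v s` for `0 ≤ s ≤ s₀`; equivalently the zero-force secants `(λ_B(e^s) − log μ)/s` lie in `[0, v]`
for `0 < s ≤ s₀`, i.e. **the right derivative of the convex `s ↦ λ_B(e^s)` at `s = 0` is `0`** — no spontaneous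
extension of the pulled self-avoiding bridge at zero force. Printed status: Beaton 2015 / Janse van
Rensburg–Whittington 2016 obtain the free energy `λ_B(y)` and its equality with `log μ` for `y ≤ 1`; the vanishing of
the zero-force slope is DC–H's sub-ballisticity read through the Chernoff transfer (lit-1's L-R47 cell).
[cite: DuminilCopinHammond2013, Theorem 1.1 and §2.4; Beaton2015, Theorem 1]
-/

noncomputable section

open Filter Topology
open Literature.Probability.LatticeModels Literature.Probability.Percolation

namespace Literature.Probability.RandomPlanarGeometry.SAW.Zd

/-- **Zero-force upper bound, unconditionally**: for every `v > 0` there is `s₀ > 0` with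
`λ_B(e^s) ≤ log μ + v·s` for `0 ≤ s ≤ s₀` (every `ℤ^{d+1}`, `d ≥ 1`).
[cite: DuminilCopinHammond2013, Theorem 1.1 and §2.4; Beaton2015, Theorem 1] -/
theorem pulledBridgeFreeEnergy_exp_le_zeroForce (d : ℕ) (hd : 1 ≤ d) {v : ℝ} (hv : 0 < v) :
    ∃ s₀ : ℝ, 0 < s₀ ∧ ∀ s : ℝ, 0 ≤ s → s ≤ s₀ →
      pulledBridgeFreeEnergy (d + 1) (Real.exp s) ≤ Real.log (connectiveConstant (d + 1)) + v * s :=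
  pulledBridgeFreeEnergy_exp_le_of_bridgeNotBallistic DuminilCopinHammond2013_bridgeNotBallistic_holds d hd hv

/-- **The zero-force secant window, unconditionally**: for every `v > 0` there is `s₀ > 0` such that
`0 ≤ (λ_B(e^s) − log μ)/s ≤ v` for `0 < s ≤ s₀`. [cite: DuminilCopinHammond2013, Theorem 1.1 and §2.4; Beaton2015, Theorem 1] -/
theorem zeroForce_secant_window (d : ℕ) (hd : 1 ≤ d) {v : ℝ} (hv : 0 < v) :
    ∃ s₀ : ℝ, 0 < s₀ ∧ ∀ s : ℝ, 0 < s → s ≤ s₀ →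
      0 ≤ (pulledBridgeFreeEnergy (d + 1) (Real.exp s) - Real.log (connectiveConstant (d + 1))) / s ∧
        (pulledBridgeFreeEnergy (d + 1) (Real.exp s) - Real.log (connectiveConstant (d + 1))) / s ≤ v :=
  zeroForce_secant_window_of_bridgeNotBallistic DuminilCopinHammond2013_bridgeNotBallistic_holds d hd hv

/-- **No spontaneous extension at zero force**: the right derivative at `s = 0` of `s ↦ λ_B(e^s)` exists and is
`0` — the zero-force secants `(λ_B(e^s) − log μ)/s` tend to `0` as `s ↓ 0` (every `ℤ^{d+1}`, `d ≥ 1`).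
[cite: DuminilCopinHammond2013, Theorem 1.1 and §2.4; Beaton2015, Theorem 1] -/
theorem tendsto_zeroForce_secant (d : ℕ) (hd : 1 ≤ d) :
    Tendsto (fun s : ℝ =>
      (pulledBridgeFreeEnergy (d + 1) (Real.exp s) - Real.log (connectiveConstant (d + 1))) / s)
      (𝓝[>] 0) (𝓝 0) := by
  rw [Metric.tendsto_nhdsWithin_nhds]
  intro ε hε
  obtain ⟨s₀, hs₀, hwin⟩ := zeroForce_secant_window d hd (half_pos hε)
  refine ⟨s₀, hs₀, fun s hs hdist => ?_⟩
  have hs' : 0 < s := hs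
  rw [Real.dist_eq, sub_zero] at hdist
  have hss : s ≤ s₀ := (le_abs_self s).trans hdist.le
  obtain ⟨h0, h1⟩ := hwin s hs' hss
  rw [Real.dist_eq, sub_zero, abs_of_nonneg h0]
  linarith

end Literature.Probability.RandomPlanarGeometry.SAW.Zd

end
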